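import Mathlib

/-!
RECONSTRUCTION (lead a2, 2026-08-16) of the evidence file `20260816T144327Z-AMGM.lean`
(planner-cruxidea-stmt-PneNP-10709-5-0, 3812 B: "self-contained Mathlib-only PROOF of the AM–GM ideal
bound ideal_embedding_sq_sum_ge"), which the harness seated as line `AMGM` of crux stmt-PneNP-10709 but
whose bytes are not mounted in this jail (run/gate/evidence). The theorem below is the verbatim
`ideal_embedding_sq_sum_ge` block of `Cruxes/Target/SketchIdeator5.lean` (rev 2, same author, same minute),
with `import Mathlib` only. Purpose: certify on the farm that this "line" has 0 stubs and no `Target_of`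
(audit: closes nothing), i.e. it is a lemma, not a skeleton; its content is already landed as
`Summit.PneNP.PneNP.Theorems.LatticeMagicTarget.stub_amgm` (p110267).
-/

namespace Summit.PneNP.PneNP.Cruxes.Target.AMGMLine

/-! ### 3. The lattice leg: AM–GM injectivity certificate for ideal lattices -/

open NumberField in
/-- **AM–GM minimum bound.** For a nonzero `x` in an ideal `I` of the ring of integers of a
number field `K` of degree `n`, `∑_σ |σ x|² ≥ n · N(I)^{2/n}` (AM–GM on the `|σ x|²` and
`N(I) ∣ |N_{K/ℚ}(x)|`). Hence the canonical-embedding minimum of `I` is `≥ √n · N(I)^{1/n}` and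
the syndrome map `e ↦ e mod I` is injective on any set of diameter `< √n · N(I)^{1/n}` — the
trapdoor-free injectivity certificate of the partial-NTT map `e ↦ (e(rᵢ) mod q)_{i ≤ k}` for
`K = ℚ(ζ_{2n})`, `I = ∏ᵢ (q, ζ − rᵢ)`, `N(I) = qᵏ`. -/
theorem ideal_embedding_sq_sum_ge (K : Type*) [Field K] [NumberField K] (I : Ideal (𝓞 K))
    (x : 𝓞 K) (hx : x ∈ I) (hx0 : x ≠ 0) :
    (Module.finrank ℚ K : ℝ) * ((Ideal.absNorm I : ℕ) : ℝ) ^ ((2 : ℝ) / (Module.finrank ℚ K : ℝ))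
      ≤ ∑ σ : K →+* ℂ, ‖σ (x : K)‖ ^ 2 := by
  classical
  set n : ℕ := Module.finrank ℚ K with hn
  have hnpos : 0 < n := Module.finrank_pos
  have hnR : (0 : ℝ) < n := by exact_mod_cast hnpos
  have hcard : Fintype.card (K →+* ℂ) = n := NumberField.Embeddings.card K ℂ
  -- (1) product of the |σ x| is |N(x)|
  have hprod : ∏ σ : K →+* ℂ, ‖σ (x : K)‖ = |((Algebra.norm ℚ (x : K) : ℚ) : ℝ)| := by
    rw [Fintype.prod_equiv RingHom.equivRatAlgHom (fun f => ‖f (x : K)‖)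
        (fun φ => ‖φ (x : K)‖) (fun _ => by simp [RingHom.equivRatAlgHom_apply]), ← norm_prod,
        ← Algebra.norm_eq_prod_embeddings ℚ ℂ (x : K)]
    rw [eq_ratCast, ← Complex.ofReal_ratCast, Complex.norm_real, Real.norm_eq_abs]
  -- (2) |N(x)| ≥ absNorm I
  have hNZ : ((Algebra.norm ℚ (x : K) : ℚ) : ℝ) = ((Algebra.norm ℤ x : ℤ) : ℝ) := by
    rw [← Algebra.coe_norm_int, Rat.cast_intCast]
  have hdvd : Ideal.absNorm I ∣ (Algebra.norm ℤ x).natAbs := by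
    rw [← Ideal.absNorm_span_singleton]
    exact Ideal.absNorm_dvd_absNorm_of_le ((Ideal.span_singleton_le_iff_mem _).mpr hx)
  have hN0 : (Algebra.norm ℤ x).natAbs ≠ 0 := by
    rw [Int.natAbs_ne_zero]
    exact Algebra.norm_ne_zero_iff.mpr hx0
  have hle : (Ideal.absNorm I : ℝ) ≤ |((Algebra.norm ℤ x : ℤ) : ℝ)| := by
    rw [← Int.cast_abs, ← Nat.cast_natAbs]
    exact_mod_cast Nat.le_of_dvd (Nat.pos_of_ne_zero hN0) hdvd
  -- (3) AM–GM with equal weights 1/n on z σ = ‖σ x‖²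
  have hz : ∀ σ ∈ (Finset.univ : Finset (K →+* ℂ)), (0 : ℝ) ≤ ‖σ (x : K)‖ ^ 2 :=
    fun σ _ => by positivity
  have hw : ∀ σ ∈ (Finset.univ : Finset (K →+* ℂ)), (0 : ℝ) ≤ (1 / (n : ℝ)) := fun _ _ => by positivity
  have hw' : ∑ σ ∈ (Finset.univ : Finset (K →+* ℂ)), (1 / (n : ℝ)) = 1 := by
    rw [Finset.sum_const, Finset.card_univ, hcard, nsmul_eq_mul]
    field_simp
  have hamgm := Real.geom_mean_le_arith_mean_weighted (Finset.univ : Finset (K →+* ℂ))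
    (fun _ => 1 / (n : ℝ)) (fun σ => ‖σ (x : K)‖ ^ 2) hw hw' hz
  -- LHS of AM–GM = (∏ ‖σ x‖²)^(1/n) = |N|^(2/n)
  have hlhs : ∏ σ ∈ (Finset.univ : Finset (K →+* ℂ)), (‖σ (x : K)‖ ^ 2) ^ (1 / (n : ℝ))
      = |((Algebra.norm ℤ x : ℤ) : ℝ)| ^ ((2 : ℝ) / (n : ℝ)) := by
    rw [Real.finset_prod_rpow _ _ (fun σ _ => by positivity), Finset.prod_pow, hprod, hNZ,
      ← Real.rpow_natCast, ← Real.rpow_mul (abs_nonneg _)]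
    norm_num [div_eq_mul_inv]
  -- RHS of AM–GM = (1/n) Σ ‖σ x‖²
  have hrhs : ∑ σ ∈ (Finset.univ : Finset (K →+* ℂ)), (1 / (n : ℝ)) * ‖σ (x : K)‖ ^ 2
      = (1 / (n : ℝ)) * ∑ σ : K →+* ℂ, ‖σ (x : K)‖ ^ 2 := by
    rw [Finset.mul_sum]
  rw [hlhs, hrhs] at hamgm
  -- (4) combine: n · (absNorm I)^(2/n) ≤ n · |N|^(2/n) ≤ Σ
  have hexp : (0 : ℝ) ≤ 2 / (n : ℝ) := by positivity
  have hmono : ((Ideal.absNorm I : ℕ) : ℝ) ^ ((2 : ℝ) / (n : ℝ))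
      ≤ |((Algebra.norm ℤ x : ℤ) : ℝ)| ^ ((2 : ℝ) / (n : ℝ)) :=
    Real.rpow_le_rpow (by positivity) hle hexp
  calc (n : ℝ) * ((Ideal.absNorm I : ℕ) : ℝ) ^ ((2 : ℝ) / (n : ℝ))
      ≤ (n : ℝ) * |((Algebra.norm ℤ x : ℤ) : ℝ)| ^ ((2 : ℝ) / (n : ℝ)) :=
        mul_le_mul_of_nonneg_left hmono hnR.le
    _ ≤ ∑ σ : K →+* ℂ, ‖σ (x : K)‖ ^ 2 := by
        have := mul_le_mul_of_nonneg_left hamgm hnR.le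
        rwa [← mul_assoc, mul_one_div_cancel hnR.ne', one_mul] at this

end Summit.PneNP.PneNP.Cruxes.Target.AMGMLine
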